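import Summits.Ventures.PercRepro.C025ProfileGirthPaving

/-!
# THE HALL FORM (C-033) OF EVERY ROW ON EVERY FINITE PAVING MATROID (night-3 g21)

The Hall form of the row `(q, u)` — for every family `𝒜` of rank-`q` sets, the level-`u` sets containing a member
of `𝒜` number at least the total price of `𝒜` (`Profile.HallIneq`) — holds on every finite PAVING matroid (every
circuit has at least `ρ(E)` points) for EVERY `q < u`: for `u ≤ ρ(E)` every set of fewer than `u` points is
independent and g19's table theorem `hallIneq_of_girth_table` (the Hall form of `(q, u)` at girth `≥ u`) applies;
for `u > ρ(E)` there is no level-`u` set and every price is `0` (`hallIneq_of_eRank_lt`).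
* `indep_of_encard_add_one_le_of_paving` — in a paving matroid every set of fewer than `u ≤ ρ(E)` points is independent;
* **`hallIneq_of_paving (hpav) (q u) (hqu : q < u) : Profile.HallIneq M q u`**.
No `def`, no `instance`, no notation.  Axioms: standard.
-/

open scoped Matroid

namespace PercRepro

open Set Finset

namespace PavingRows

variable {α : Type} [DecidableEq α] {M : Matroid α} [M.Finite]

omit [DecidableEq α] in
/-- In a paving matroid every set of fewer than `u` points, `u ≤ ρ(E)`, is independent: a circuit inside it would
have fewer than `u ≤ ρ(E)` points. -/
theorem indep_of_encard_add_one_le_of_paving (hpav : ∀ C, M.IsCircuit C → M.eRank ≤ C.encard) {u : ℕ}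
    (hu : (u : ℕ∞) ≤ M.eRank) : ∀ T ⊆ M.E, T.encard + 1 ≤ (u : ℕ∞) → M.Indep T := by
  intro T hT hTu
  by_contra hind
  obtain ⟨C, hCT, hC⟩ := ((Matroid.not_indep_iff hT).1 hind).exists_isCircuit_subset
  have h1 : T.encard + 1 ≤ T.encard :=
    hTu.trans (hu.trans ((hpav C hC).trans (Set.encard_le_encard hCT)))
  have h2 : T.encard ≠ ⊤ := (Set.Finite.subset Matroid.Finite.ground_finite hT).encard_lt_top.ne
  exact lt_irrefl _ ((ENat.add_one_le_iff h2).1 h1)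

/-- **The Hall form (C-033) of every row `(q, u)`, `q < u`, on every finite paving matroid**: `u ≤ ρ(E)` by the
table theorem at girth `≥ u`, `u > ρ(E)` trivially. -/
theorem hallIneq_of_paving (hpav : ∀ C, M.IsCircuit C → M.eRank ≤ C.encard) (q u : ℕ) (hqu : q < u) :
    Profile.HallIneq M q u := by
  by_cases hur : (u : ℕ∞) ≤ M.eRank
  · exact GirthRows.hallIneq_of_girth_table q u hqu (indep_of_encard_add_one_le_of_paving hpav hur)
  · rw [not_le] at hur
    exact GirthRows.hallIneq_of_eRank_lt hur

end PavingRows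

end PercRepro
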